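import Summits.AtomisticToContinuum.BoseEinsteinCondensation.Theses.BECBathMassLiouville
import Literature.MathematicalPhysics.QuantumManyBody.CouplingPathSpectralRigidity

/-!
# Route `BECBathMassLiouville` — support item `LightBathCoherence` (stmt-AtomisticToContinuum-13802):
the tagged Poincaré step and the free-gas corner

Supports (does not close) stmt-AtomisticToContinuum-13802,
`Summit.AtomisticToContinuum.BoseEinsteinCondensation.Theses.BECBathMassLiouville.LightBathCoherence`
(complete coherence of the tagged boson in the light-bath limit `η → 0`, uniformly in the
thermodynamic limit — an open problem as typed; see the item's evidence note).

What is proved here, for the EXACT objects of the item (tagged particle = head of `Matrix.vecCons`,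
no permutation symmetry, periodicity only on the generators, `ℝ≥0∞`-valued cell integrals):

* `lintegral_cellN_normSq_le_taggedZeroModeOccupation_add` — the tagged Poincaré–Wirtinger step
  `∫_{cell^{N+1}} |ψ|² ≤ ⟨ψ, P_{Ω,0} ψ⟩ + (L/2π)² ∫_{cell^{N+1}} |∇₀ψ|²` for every `C¹` function that is
  `Lℤ³`-periodic in the tagged coordinate (the one-particle inequality `lintegral_cell_normSq_le` on
  every slice `x₀ ↦ ψ(x₀, Y)`, integrated over the bath; `one_le_taggedZeroModeOccupation_add` of
  `CouplingPathSpectralRigidity.lean` is the same fact for bath-symmetric `TaggedPeriodicTrialState`s,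
  whose symmetry the item does not assume).
* `ofReal_one_sub_mul_le_condensateOccupation` — hence a cell-normalised such `ψ` with tagged
  kinetic energy `(L/2π)² ∫ |∇₀ψ|² ≤ ε` has `condensateOccupation (N+1) L ψ ≥ (1 - ε)(N + 1)`:
  the conclusion of the item follows from an infrared bound on the TAGGED kinetic energy alone.
* `lightBathCoherence_zeroPotential` — the body of `LightBathCoherence` at the admissible potential
  `v = 0` (every `ρ`, `ε`, `η`, `N`; `δ = ε (2π/L)²`): the infimum of the deformed energy is `0`
  (constant state), a `δ`-near-minimiser has tagged kinetic energy `≤ δ`, and the Poincaré step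
  closes. This certifies the reading of every symbol of the item (non-vacuity of the admissible
  class, the `⨅`, the cast `(1 - ε) * (N + 1)`) and isolates what the interacting case must supply:
  a bound `∫ |∇₀ψ|² ≪ L⁻²` is NOT available for `v ≠ 0` (the a-priori budget is `∫ |∇₀ψ|² ≤ ρ ∫v`,
  barrier `KineticGapLengthScales`), so the item needs infrared control of the bath's response in
  the thermodynamic limit.
-/

noncomputable section

namespace Summit.AtomisticToContinuum.BoseEinsteinCondensation.Theorems

open MeasureTheory Filter
open scoped ENNReal NNReal
open Literature.MathematicalPhysics.QuantumManyBody.BoseGas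

namespace LightBathCoherence

variable {N : ℕ} {L : ℝ}

/-- **Tagged Poincaré–Wirtinger step** (no symmetry, no normalisation assumed): for a `C¹`
function `ψ : (ℝ³)^{N+1} → ℂ` that is `Lℤ³`-periodic in the tagged coordinate `x₀`,
`∫_{[0,L)^{3(N+1)}} |ψ|² ≤ ⟨ψ, P_{Ω,0} ψ⟩ + (L/2π)² ∫_{[0,L)^{3(N+1)}} |∇₀ψ|²`, where
`⟨ψ, P_{Ω,0} ψ⟩ = taggedZeroModeOccupation N L ψ = L⁻³ ∫ |∫ ψ(x₀, Y) dx₀|² dY`. The one-particle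
projection-form Poincaré inequality `lintegral_cell_normSq_le` on every slice, integrated over the
bath by Tonelli (`setLIntegral_cellN_succ_right`). [folklore] -/
theorem lintegral_cellN_normSq_le_taggedZeroModeOccupation_add (hL : 0 < L)
    {ψ : Config (N + 1) → ℂ} (hψ : ContDiff ℝ 1 ψ)
    (hper : ∀ (X : Config (N + 1)) (k : Fin 3),
      ψ (X + Pi.single (0 : Fin (N + 1)) (EuclideanSpace.single k L)) = ψ X) :
    ∫⁻ X in cellN (N + 1) L, (‖ψ X‖₊ : ℝ≥0∞) ^ 2 ≤
      taggedZeroModeOccupation N L ψ + ENNReal.ofReal ((L / (2 * Real.pi)) ^ 2) *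
        ∫⁻ X in cellN (N + 1) L, ∑ k : Fin 3,
          (‖fderiv ℝ ψ X (Pi.single 0 (EuclideanSpace.single k (1 : ℝ)))‖₊ : ℝ≥0∞) ^ 2 := by
  have hψd : Differentiable ℝ ψ := hψ.differentiable one_ne_zero
  set C : ℝ≥0∞ := ENNReal.ofReal ((L / (2 * Real.pi)) ^ 2) with hC
  set V : ℝ≥0∞ := ENNReal.ofReal L ^ 3 with hV
  set g : Config (N + 1) → ℝ≥0∞ := fun X => ∑ k : Fin 3,
    (‖fderiv ℝ ψ X (Pi.single 0 (EuclideanSpace.single k (1 : ℝ)))‖₊ : ℝ≥0∞) ^ 2 with hg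
  have hgm : Measurable g := measurable_gradSqAt 0 ψ
  have hF : Measurable fun X => (‖ψ X‖₊ : ℝ≥0∞) ^ 2 :=
    (hψ.continuous.measurable.nnnorm.coe_nnreal_ennreal).pow_const _
  have hVi : V⁻¹ ≠ ⊤ := ENNReal.inv_ne_top.2 (pow_ne_zero _ (ENNReal.ofReal_pos.2 hL).ne')
  have hmeas : Measurable fun Y : Config N => ∫⁻ x in cell L, g (Matrix.vecCons x Y) := by
    have hunc : Measurable
        (Function.uncurry fun (Y : Config N) (x : Space) => g (Matrix.vecCons x Y)) :=
      measurable_swap_iff.1 (hgm.comp measurable_vecCons)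
    exact hunc.lintegral_prod_right
  -- the one-particle Poincaré inequality on every slice `x₀ ↦ ψ(x₀, Y)`
  have hslice : ∀ Y : Config N, ∫⁻ x in cell L, (‖ψ (Matrix.vecCons x Y)‖₊ : ℝ≥0∞) ^ 2 ≤
      V⁻¹ * (‖∫ x in cell L, ψ (Matrix.vecCons x Y)‖₊ : ℝ≥0∞) ^ 2 +
        C * ∫⁻ x in cell L, g (Matrix.vecCons x Y) := by
    intro Y
    have hφ : ContDiff ℝ 1 fun y : Space => ψ (Matrix.vecCons y Y) :=
      hψ.comp (contDiff_vecCons_left Y)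
    have hperY : ∀ (y : Space) (k : Fin 3),
        ψ (Matrix.vecCons (y + EuclideanSpace.single k L) Y) = ψ (Matrix.vecCons y Y) :=
      fun y k => by rw [vecCons_add_single_zero, hper]
    have h := lintegral_cell_normSq_le hL hφ hperY
    rw [ofReal_mul_nnnorm_cellFourierCoeff_zero_sq hL] at h
    simpa only [gradSqC_vecCons_slice hψd] using h
  calc ∫⁻ X in cellN (N + 1) L, (‖ψ X‖₊ : ℝ≥0∞) ^ 2
      = ∫⁻ Y in cellN N L, ∫⁻ x in cell L, (‖ψ (Matrix.vecCons x Y)‖₊ : ℝ≥0∞) ^ 2 :=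
        setLIntegral_cellN_succ_right hF
    _ ≤ ∫⁻ Y in cellN N L, (V⁻¹ * (‖∫ x in cell L, ψ (Matrix.vecCons x Y)‖₊ : ℝ≥0∞) ^ 2 +
          C * ∫⁻ x in cell L, g (Matrix.vecCons x Y)) := lintegral_mono hslice
    _ = (V⁻¹ * ∫⁻ Y in cellN N L, (‖∫ x in cell L, ψ (Matrix.vecCons x Y)‖₊ : ℝ≥0∞) ^ 2) +
          C * ∫⁻ Y in cellN N L, ∫⁻ x in cell L, g (Matrix.vecCons x Y) := by
        rw [lintegral_add_right _ (hmeas.const_mul C), lintegral_const_mul' _ _ hVi,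
          lintegral_const_mul' C _ ENNReal.ofReal_ne_top]
    _ = taggedZeroModeOccupation N L ψ + C * ∫⁻ X in cellN (N + 1) L, g X := by
        rw [taggedZeroModeOccupation, ← setLIntegral_cellN_succ_right hgm]

/-- **Zero-mode weight of the tagged particle from its own kinetic energy.** If `ψ` is `C¹`,
`Lℤ³`-periodic in the tagged coordinate and cell-normalised, and its tagged kinetic energy is small
on the scale of the free gap, `(L/2π)² ∫_{cell^{N+1}} |∇₀ψ|² ≤ ε`, then
`(1 - ε)(N + 1) ≤ condensateOccupation (N+1) L ψ` (`= (N+1) ⟨ψ, P_{Ω,0} ψ⟩`). [folklore] -/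
theorem ofReal_one_sub_mul_le_condensateOccupation (hL : 0 < L)
    {ψ : Config (N + 1) → ℂ} (hψ : ContDiff ℝ 1 ψ)
    (hper : ∀ (X : Config (N + 1)) (k : Fin 3),
      ψ (X + Pi.single (0 : Fin (N + 1)) (EuclideanSpace.single k L)) = ψ X)
    (hnorm : ∫⁻ X in cellN (N + 1) L, (‖ψ X‖₊ : ℝ≥0∞) ^ 2 = 1) {ε : ℝ} (hε : 0 ≤ ε)
    (hT : ENNReal.ofReal ((L / (2 * Real.pi)) ^ 2) *
        ∫⁻ X in cellN (N + 1) L, ∑ k : Fin 3,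
          (‖fderiv ℝ ψ X (Pi.single 0 (EuclideanSpace.single k (1 : ℝ)))‖₊ : ℝ≥0∞) ^ 2 ≤
      ENNReal.ofReal ε) :
    ENNReal.ofReal ((1 - ε) * (N + 1)) ≤ condensateOccupation (N + 1) L ψ := by
  have h1 : (1 : ℝ≥0∞) ≤ taggedZeroModeOccupation N L ψ + ENNReal.ofReal ε :=
    (hnorm.symm.trans_le (lintegral_cellN_normSq_le_taggedZeroModeOccupation_add hL hψ hper)).trans
      (add_le_add le_rfl hT)
  have h2 : ENNReal.ofReal (1 * ((N + 1 : ℕ) : ℝ)) ≤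
      condensateOccupation (N + 1) L ψ + ENNReal.ofReal (ε * ((N + 1 : ℕ) : ℝ)) := by
    have h := mul_le_mul' (le_refl ((N + 1 : ℕ) : ℝ≥0∞)) h1
    rw [mul_one, mul_add, Nat.cast_succ, succ_mul_taggedZeroModeOccupation hL] at h
    rw [one_mul, ENNReal.ofReal_natCast, ENNReal.ofReal_mul hε, ENNReal.ofReal_natCast,
      Nat.cast_succ, mul_comm (ENNReal.ofReal ε)]
    exact h
  -- `ofReal (1·M) ≤ n + ofReal (ε·M)` ⇒ `ofReal ((1-ε)·M) ≤ n` (truncated subtraction bookkeeping)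
  have h3 : ENNReal.ofReal ((1 - ε) * ((N + 1 : ℕ) : ℝ)) ≤ condensateOccupation (N + 1) L ψ := by
    rcases le_or_gt ((1 - ε) * ((N + 1 : ℕ) : ℝ)) 0 with hneg | hpos
    · rw [ENNReal.ofReal_of_nonpos hneg]
      exact bot_le
    · refine ENNReal.le_of_add_le_add_right ENNReal.ofReal_ne_top (h2.trans' (le_of_eq ?_))
      rw [← ENNReal.ofReal_add hpos.le (by positivity)]
      congr 1
      ring
  simpa only [Nat.cast_succ] using h3

/-- The admissible potential `v = 0` has no pair interaction on the torus either:
`∑_{i<j} 0^per(xᵢ - xⱼ) = 0`. [folklore] -/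
theorem periodicInteraction_zeroPotential (L : ℝ) (X : Config (N + 1)) :
    periodicInteraction 0 L X = 0 := by
  unfold periodicInteraction
  simp only [periodizedPotential_zero, Finset.sum_const_zero]

/-- **The free-gas corner of `LightBathCoherence`.** For the admissible potential `v = 0`
(`isRepulsiveFiniteRange_zero`, `∫ 0 = 0 ≠ ⊤`) the body of the item holds — in fact for every
`ρ > 0`, `ε > 0`, every `η > 0` (any `η₀`), every `N`, with `δ = ε (2π/L)²`, `L = sideLength ρ (N+1)`:
the infimum of the deformed energy `∫ |∇₀φ|² + η⁻¹ ∑_{j≥1} |∇ⱼφ|²` over `C¹`, periodic,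
cell-normalised `φ` is `0` (the constant state `L^{-3(N+1)/2}`), so a `δ`-near-minimiser has tagged
kinetic energy `≤ δ` and `ofReal_one_sub_mul_le_condensateOccupation` gives
`condensateOccupation (N+1) L ψ ≥ (1 - ε)(N + 1)`. The Wirtinger mechanism named in the route text
("v ≡ 0 is included (free torus gas: Wirtinger)"). [folklore] -/
theorem lightBathCoherence_zeroPotential :
    ∀ ρ : ℝ, 0 < ρ → ∀ ε : ℝ, 0 < ε → ∃ η₀ : ℝ, 0 < η₀ ∧ ∀ η : ℝ, 0 < η → η < η₀ →
      ∀ᶠ N : ℕ in Filter.atTop, ∃ δ : ENNReal, 0 < δ ∧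
        ∀ ψ : Config (N + 1) → ℂ, ContDiff ℝ 1 ψ →
          (∀ (X : Config (N + 1)) (i : Fin (N + 1)) (k : Fin 3),
            ψ (X + Pi.single i (EuclideanSpace.single k (sideLength ρ (N + 1)))) = ψ X) →
          (∫⁻ X in cellN (N + 1) (sideLength ρ (N + 1)), (‖ψ X‖₊ : ENNReal) ^ 2) = 1 →
          (∫⁻ X in cellN (N + 1) (sideLength ρ (N + 1)),
              (∑ k : Fin 3, (‖fderiv ℝ ψ X (Pi.single (0 : Fin (N + 1))
                (EuclideanSpace.single k (1 : ℝ)))‖₊ : ENNReal) ^ 2) +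
              ENNReal.ofReal η⁻¹ * (∑ j : Fin N, ∑ k : Fin 3, (‖fderiv ℝ ψ X
                (Pi.single j.succ (EuclideanSpace.single k (1 : ℝ)))‖₊ : ENNReal) ^ 2) +
              periodicInteraction 0 (sideLength ρ (N + 1)) X * (‖ψ X‖₊ : ENNReal) ^ 2) ≤
            (⨅ (φ : Config (N + 1) → ℂ) (_ : ContDiff ℝ 1 φ ∧
                (∀ (X : Config (N + 1)) (i : Fin (N + 1)) (k : Fin 3),
                  φ (X + Pi.single i (EuclideanSpace.single k (sideLength ρ (N + 1)))) = φ X) ∧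
                (∫⁻ X in cellN (N + 1) (sideLength ρ (N + 1)), (‖φ X‖₊ : ENNReal) ^ 2) = 1),
              ∫⁻ X in cellN (N + 1) (sideLength ρ (N + 1)),
                (∑ k : Fin 3, (‖fderiv ℝ φ X (Pi.single (0 : Fin (N + 1))
                  (EuclideanSpace.single k (1 : ℝ)))‖₊ : ENNReal) ^ 2) +
                ENNReal.ofReal η⁻¹ * (∑ j : Fin N, ∑ k : Fin 3, (‖fderiv ℝ φ X
                  (Pi.single j.succ (EuclideanSpace.single k (1 : ℝ)))‖₊ : ENNReal) ^ 2) +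
                periodicInteraction 0 (sideLength ρ (N + 1)) X * (‖φ X‖₊ : ENNReal) ^ 2) + δ →
          ENNReal.ofReal ((1 - ε) * (N + 1)) ≤
            condensateOccupation (N + 1) (sideLength ρ (N + 1)) ψ := by
  intro ρ hρ ε hε
  refine ⟨1, one_pos, fun η _ _ => Filter.Eventually.of_forall fun N => ?_⟩
  set L : ℝ := sideLength ρ (N + 1) with hLdef
  have hL : 0 < L := by
    rw [hLdef]
    exact Real.rpow_pos_of_pos (div_pos (Nat.cast_pos.2 (Nat.succ_pos N)) hρ) _
  set C : ℝ≥0∞ := ENNReal.ofReal ((L / (2 * Real.pi)) ^ 2) with hC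
  set δ : ℝ≥0∞ := ENNReal.ofReal (ε * (2 * Real.pi / L) ^ 2) with hδ
  have hδpos : 0 < δ := ENNReal.ofReal_pos.2 (by positivity)
  have hCδ : C * δ = ENNReal.ofReal ε := by
    rw [hC, hδ, ← ENNReal.ofReal_mul (sq_nonneg _)]
    congr 1
    field_simp
  refine ⟨δ, hδpos, fun ψ hψ hper hnorm hE => ?_⟩
  -- the constant state is admissible with deformed energy `0`, so the infimum is `0`
  set Ω := TaggedPeriodicTrialState.const N hL with hΩ
  have hΩE : (∫⁻ X in cellN (N + 1) L,
      (∑ k : Fin 3, (‖fderiv ℝ Ω.ψ X (Pi.single (0 : Fin (N + 1))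
        (EuclideanSpace.single k (1 : ℝ)))‖₊ : ENNReal) ^ 2) +
      ENNReal.ofReal η⁻¹ * (∑ j : Fin N, ∑ k : Fin 3, (‖fderiv ℝ Ω.ψ X
        (Pi.single j.succ (EuclideanSpace.single k (1 : ℝ)))‖₊ : ENNReal) ^ 2) +
      periodicInteraction 0 L X * (‖Ω.ψ X‖₊ : ENNReal) ^ 2) = 0 := by
    have hψΩ : Ω.ψ = fun _ => (((Real.sqrt (L ^ 3))⁻¹ : ℂ) ^ (N + 1)) := rfl
    simp only [hψΩ, fderiv_const_apply, periodicInteraction_zeroPotential]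
    simp
  have hinf : (⨅ (φ : Config (N + 1) → ℂ) (_ : ContDiff ℝ 1 φ ∧
      (∀ (X : Config (N + 1)) (i : Fin (N + 1)) (k : Fin 3),
        φ (X + Pi.single i (EuclideanSpace.single k L)) = φ X) ∧
      (∫⁻ X in cellN (N + 1) L, (‖φ X‖₊ : ENNReal) ^ 2) = 1),
      ∫⁻ X in cellN (N + 1) L,
        (∑ k : Fin 3, (‖fderiv ℝ φ X (Pi.single (0 : Fin (N + 1))
          (EuclideanSpace.single k (1 : ℝ)))‖₊ : ENNReal) ^ 2) +
        ENNReal.ofReal η⁻¹ * (∑ j : Fin N, ∑ k : Fin 3, (‖fderiv ℝ φ X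
          (Pi.single j.succ (EuclideanSpace.single k (1 : ℝ)))‖₊ : ENNReal) ^ 2) +
        periodicInteraction 0 L X * (‖φ X‖₊ : ENNReal) ^ 2) = 0 :=
    le_antisymm ((iInf₂_le Ω.ψ ⟨Ω.contDiff, Ω.periodic, Ω.norm_eq⟩).trans hΩE.le) bot_le
  rw [hinf, zero_add] at hE
  -- the tagged kinetic energy is at most the deformed energy, hence `≤ δ`
  have hT : (∫⁻ X in cellN (N + 1) L, ∑ k : Fin 3,
      (‖fderiv ℝ ψ X (Pi.single 0 (EuclideanSpace.single k (1 : ℝ)))‖₊ : ℝ≥0∞) ^ 2) ≤ δ :=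
    (lintegral_mono fun X => le_add_right (le_add_right le_rfl)).trans hE
  have hCT : C * (∫⁻ X in cellN (N + 1) L, ∑ k : Fin 3,
      (‖fderiv ℝ ψ X (Pi.single 0 (EuclideanSpace.single k (1 : ℝ)))‖₊ : ℝ≥0∞) ^ 2) ≤
      ENNReal.ofReal ε :=
    (mul_le_mul' le_rfl hT).trans hCδ.le
  exact ofReal_one_sub_mul_le_condensateOccupation hL hψ (fun X k => hper X 0 k) hnorm hε.le hCT

end LightBathCoherence

end Summit.AtomisticToContinuum.BoseEinsteinCondensation.Theorems

end
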